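import Summits.Ventures.QEC.CircuitDistance.PortCleanCycle
import Summits.Ventures.QEC.CircuitDistance.DEMCheckSound
import HarnessLib

/-!
# P3-PORT (A3): the SINGLE-FAULT STRUCTURE THEOREM and linearity of detectors / residuals over fault sets
# (cell `qec`, experiment CDX, seat qec-cdx-type-1)

* `synZ_eq_mulVec` / `synX_eq_mulVec`: the circuit-order syndrome XORs ARE `H^Z = [Bᵀ|Aᵀ]`, `H^X = [A|B]` of `S.toCode`
  (for EVERY `SMCode`, repeated monomials included);
* `run1F` and **`run1_eq`** (STRUCTURE THEOREM): for a fault in cycle `c ∈ [1, Nc]`, `run1 S Nc f` is a closed formula in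
  `shape S f` — flips `μ` in cycle `c`; cycle `c+1` reads `ζ ⊕ H^Z·Eˣ` / `H^X·Eᶻ`; later cycles the true syndromes; data
  frame `E`; `run1_of_not_mem` (faults outside the circuit do nothing);
* parity-sum lemmas (`bsum_singleton`, `bsum_xor`, `toZ2_bsum`; `bsum_insert`/`bsum_empty` are eng-1's in
  `DEMCheckSound`) and LINEARITY: `flipZ_eq_bsum`, `detZ_eq_bsum`, `detX_eq_bsum`, `dataX_eq_sum`, `dataZ_eq_sum`,
  `dataX_singleton` (= the shape's data `x`-bits).
Generic in `S`; nothing here asserts a value of `d_circ`.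
-/

namespace Summit.Ventures.QEC.CircuitDistance

open Literature.InformationTheory.QuantumCodes

variable {ℓ m : ℕ} [NeZero ℓ] [NeZero m]

/-! ## The syndromes are the parity checks -/

/-- A shifted indicator picks one term of a sum. -/
theorem sum_indicator_sub (j μ : BB.Mono ℓ m) (w : BB.Mono ℓ m → ZMod 2) :
    ∑ i, (if j - i = μ then (1 : ZMod 2) else 0) * w i = w (j - μ) := by
  have : ∀ i, (if j - i = μ then (1 : ZMod 2) else 0) * w i = if j - μ = i then w i else 0 := by
    intro i
    by_cases h : j - i = μ
    · have : j - μ = i := by rw [← h]; abel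
      simp [h, this]
    · have : j - μ ≠ i := by intro h'; apply h; rw [← h']; abel
      simp [h, this]
  simp_rw [this]
  rw [Finset.sum_ite_eq]; simp

/-- A shifted indicator picks one term of a sum (additive form). -/
theorem sum_indicator_add (i μ : BB.Mono ℓ m) (w : BB.Mono ℓ m → ZMod 2) :
    ∑ j, (if j - i = μ then (1 : ZMod 2) else 0) * w j = w (i + μ) := by
  have : ∀ j, (if j - i = μ then (1 : ZMod 2) else 0) * w j = if i + μ = j then w j else 0 := by
    intro j
    by_cases h : j - i = μ
    · have : i + μ = j := by rw [← h]; abel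
      simp [h, this]
    · have : i + μ ≠ j := by intro h'; apply h; rw [← h']; abel
      simp [h, this]
  simp_rw [this]
  rw [Finset.sum_ite_eq]; simp

omit [NeZero ℓ] [NeZero m] in
/-- The value of a BB-code polynomial `M₁ + M₂ + M₃` given by three monomials. -/
theorem poly3_apply (a b c μ : BB.Mono ℓ m) :
    (BB.monomial a.1 a.2 + BB.monomial b.1 b.2 + BB.monomial c.1 c.2 : BB.Poly ℓ m) μ =
      (if μ = a then 1 else 0) + (if μ = b then 1 else 0) + (if μ = c then 1 else 0) := by
  simp only [Pi.add_apply, BB.monomial, Prod.mk.eta, Pi.single_apply]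

/-- `toZ2 b q = 1 ↔ b q`. -/
theorem toZ2_apply_eq_one {α : Type*} (b : α → Bool) (q : α) : (toZ2 b q = 1) ↔ b q = true := by
  unfold toZ2; split_ifs with h <;> simp [h]

/-- `synZ` IS the parity check `H^Z = [Bᵀ | Aᵀ]` of the code `S.toCode` applied to the error. -/
theorem synZ_eq_mulVec (S : SMCode ℓ m) (ex : BB.Mono ℓ m ⊕ BB.Mono ℓ m → Bool) (j : BB.Mono ℓ m) :
    toZ2 (synZ S ex) j = (S.toCode.HZ.mulVec (toZ2 ex)) j := by
  rw [BB.Code.HZ_eq, Matrix.mulVec, dotProduct, Fintype.sum_sum_type]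
  simp only [Matrix.fromCols_apply_inl, Matrix.fromCols_apply_inr, Matrix.transpose_apply, BB.toMatrix_apply]
  have hA : S.toCode.A = S.polyA := rfl
  have hB : S.toCode.B = S.polyB := rfl
  rw [hA, hB]
  simp only [SMCode.polyA, SMCode.polyB, poly3_apply, add_mul, Finset.sum_add_distrib, sum_indicator_sub]
  -- left side: unfold the xor chain
  have : toZ2 (synZ S ex) j = toZ2 ex (.inr (j - S.amon 0)) + toZ2 ex (.inr (j - S.amon 2)) + toZ2 ex (.inl (j - S.bmon 0))
      + toZ2 ex (.inl (j - S.bmon 1)) + toZ2 ex (.inl (j - S.bmon 2)) + toZ2 ex (.inr (j - S.amon 1)) := by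
    unfold toZ2 synZ
    rcases Bool.eq_false_or_eq_true (ex (.inr (j - S.amon 0))) with h0 | h0 <;>
    rcases Bool.eq_false_or_eq_true (ex (.inr (j - S.amon 2))) with h1 | h1 <;>
    rcases Bool.eq_false_or_eq_true (ex (.inl (j - S.bmon 0))) with h2 | h2 <;>
    rcases Bool.eq_false_or_eq_true (ex (.inl (j - S.bmon 1))) with h3 | h3 <;>
    rcases Bool.eq_false_or_eq_true (ex (.inl (j - S.bmon 2))) with h4 | h4 <;>
    rcases Bool.eq_false_or_eq_true (ex (.inr (j - S.amon 1))) with h5 | h5 <;>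
    simp only [h0, h1, h2, h3, h4, h5] <;> decide
  rw [this]
  unfold toZ2
  ring

/-- `synX` IS the parity check `H^X = [A | B]` applied to the error. -/
theorem synX_eq_mulVec (S : SMCode ℓ m) (ez : BB.Mono ℓ m ⊕ BB.Mono ℓ m → Bool) (i : BB.Mono ℓ m) :
    toZ2 (synX S ez) i = (S.toCode.HX.mulVec (toZ2 ez)) i := by
  rw [BB.Code.HX_eq, Matrix.mulVec, dotProduct, Fintype.sum_sum_type]
  simp only [Matrix.fromCols_apply_inl, Matrix.fromCols_apply_inr, BB.toMatrix_apply]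
  have hA : S.toCode.A = S.polyA := rfl
  have hB : S.toCode.B = S.polyB := rfl
  rw [hA, hB]
  simp only [SMCode.polyA, SMCode.polyB, poly3_apply, add_mul, Finset.sum_add_distrib, sum_indicator_add]
  have : toZ2 (synX S ez) i = toZ2 ez (.inl (i + S.amon 1)) + toZ2 ez (.inr (i + S.bmon 1)) + toZ2 ez (.inr (i + S.bmon 0))
      + toZ2 ez (.inr (i + S.bmon 2)) + toZ2 ez (.inl (i + S.amon 0)) + toZ2 ez (.inl (i + S.amon 2)) := by
    unfold toZ2 synX
    rcases Bool.eq_false_or_eq_true (ez (.inl (i + S.amon 1))) with h0 | h0 <;>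
    rcases Bool.eq_false_or_eq_true (ez (.inr (i + S.bmon 1))) with h1 | h1 <;>
    rcases Bool.eq_false_or_eq_true (ez (.inr (i + S.bmon 0))) with h2 | h2 <;>
    rcases Bool.eq_false_or_eq_true (ez (.inr (i + S.bmon 2))) with h3 | h3 <;>
    rcases Bool.eq_false_or_eq_true (ez (.inl (i + S.amon 0))) with h4 | h4 <;>
    rcases Bool.eq_false_or_eq_true (ez (.inl (i + S.amon 2))) with h5 | h5 <;>
    simp only [h0, h1, h2, h3, h4, h5] <;> decide
  rw [this]
  unfold toZ2
  ring

/-! ## SINGLE-FAULT STRUCTURE THEOREM -/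

/-- The closed formula for the final state of the `Nc`-cycle circuit with one fault (cycle `c = f.cyc ∈ [1, Nc]`):
outcome flips `μ` of the shape in cycle `c`; cycle `c+1` reads `ζ ⊕ synZ(Eˣ)` / `synX(Eᶻ)`; later cycles the true
syndromes; frame = the shape's frame if `Nc = c`, else its cleaned version. -/
def run1F (S : SMCode ℓ m) (Nc : ℕ) (f : Fault ℓ m) : State ℓ m :=
  ⟨if Nc = f.cyc then (shape S f).frame else cleanFrame S (shape S f).frame,
   fun t i => if f.cyc < t ∧ t ≤ Nc then synX S (shape S f).frame.dataZb i else (shape S f).mX t i,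
   fun t j => if f.cyc < t ∧ t ≤ Nc then
      xor (if t = f.cyc + 1 then (shape S f).frame.ancZx j else false) (synZ S (shape S f).frame.dataXb j)
    else (shape S f).mZ t j⟩

/-- The formula's frame keeps the shape's data `x`-bits. -/
theorem run1F_dataXb (S : SMCode ℓ m) (Nc : ℕ) (f : Fault ℓ m) :
    (run1F S Nc f).frame.dataXb = (shape S f).frame.dataXb := by
  unfold run1F; dsimp only; split_ifs
  · rfl
  · exact cleanFrame_dataXb S _

/-- The formula's frame keeps the shape's data `z`-bits. -/
theorem run1F_dataZb (S : SMCode ℓ m) (Nc : ℕ) (f : Fault ℓ m) :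
    (run1F S Nc f).frame.dataZb = (shape S f).frame.dataZb := by
  unfold run1F; dsimp only; split_ifs
  · rfl
  · exact cleanFrame_dataZb S _

/-- The formula's `Z`-ancilla `x`-bits: the shape's in the fault's own cycle, clear afterwards. -/
theorem run1F_ancZx (S : SMCode ℓ m) (Nc : ℕ) (f : Fault ℓ m) (j : BB.Mono ℓ m) :
    (run1F S Nc f).frame.ancZx j = if Nc = f.cyc then (shape S f).frame.ancZx j else false := by
  unfold run1F; dsimp only; split_ifs
  · rfl
  · rfl

/-- The formula's frame has `z`-clear `Z`-ancillas. -/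
theorem run1F_Zz (S : SMCode ℓ m) (Nc : ℕ) (f : Fault ℓ m) (j : BB.Mono ℓ m) : ((run1F S Nc f).frame (Reg.Z, j)).2 = false := by
  unfold run1F; dsimp only; split_ifs
  · exact shape_ancZz S f j
  · rfl

/-- Cleaning the formula's frame gives the cleaned shape frame. -/
theorem cleanFrame_run1F (S : SMCode ℓ m) (Nc : ℕ) (f : Fault ℓ m) :
    cleanFrame S (run1F S Nc f).frame = cleanFrame S (shape S f).frame := by
  unfold run1F; dsimp only; split_ifs
  · rfl
  · exact cleanFrame_cleanFrame S _

/-- A fault whose event is not in the circuit has no effect. -/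
theorem run1_of_not_mem (S : SMCode ℓ m) (Nc : ℕ) (f : Fault ℓ m) (h : f.ev ∉ allEvents Nc) :
    run1 S Nc f = State.init := by
  unfold run1; rw [simulate_of_not_mem S f h]; exact evolve_init S _

/-- The structure theorem, inductive form. -/
theorem run1_eq_aux (S : SMCode ℓ m) (f : Fault ℓ m) (h₁ : 1 ≤ f.cyc) (n : ℕ) :
    run1 S (f.cyc + n) f = run1F S (f.cyc + n) f := by
  induction n with
  | zero =>
    unfold run1
    obtain ⟨c₀, hc₀⟩ : ∃ c₀, f.cyc = c₀ + 1 := ⟨f.cyc - 1, by omega⟩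
    have hnot : f.ev ∉ allEvents c₀ := by rw [mem_allEvents_iff, Fault.ev_cyc]; omega
    rw [add_zero, hc₀, allEvents_succ, simulate_append, simulate_of_not_mem S f hnot, evolve_init]
    have hsh : simulate S f (cycleEvents (c₀ + 1)) State.init = shape S f := by unfold shape; rw [hc₀]
    rw [hsh]; unfold run1F
    refine State.ext' ?_ ?_ ?_
    · simp [hc₀]
    · funext t i; dsimp only; rw [if_neg]; omega
    · funext t j; dsimp only; rw [if_neg]; omega
  | succ n ih =>
    unfold run1 at ih ⊢
    have hnot : f.ev ∉ cycleEvents (f.cyc + n + 1) := by rw [mem_cycleEvents_iff, Fault.ev_cyc]; omega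
    rw [← add_assoc, allEvents_succ, simulate_append, ih, simulate_of_not_mem S f hnot,
      evolve_cycleEvents S _ _ (run1F_Zz S _ f)]
    have hmX : ∀ t i, (run1F S (f.cyc + n) f).mX t i =
        if f.cyc < t ∧ t ≤ f.cyc + n then synX S (shape S f).frame.dataZb i else (shape S f).mX t i := fun _ _ => rfl
    have hmZ : ∀ t j, (run1F S (f.cyc + n) f).mZ t j =
        if f.cyc < t ∧ t ≤ f.cyc + n then
          xor (if t = f.cyc + 1 then (shape S f).frame.ancZx j else false) (synZ S (shape S f).frame.dataXb j)
        else (shape S f).mZ t j := fun _ _ => rfl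
    refine State.ext' ?_ ?_ ?_
    · rw [cleanFrame_run1F]; unfold run1F; dsimp only; rw [if_neg]; omega
    · funext t i
      dsimp only
      rw [run1F_dataZb, hmX]
      show _ = (if f.cyc < t ∧ t ≤ f.cyc + n + 1 then synX S (shape S f).frame.dataZb i else (shape S f).mX t i)
      by_cases ht : t = f.cyc + n + 1
      · subst ht
        have e1 : ¬ (f.cyc < f.cyc + n + 1 ∧ f.cyc + n + 1 ≤ f.cyc + n) := by omega
        have e2 : (f.cyc < f.cyc + n + 1 ∧ f.cyc + n + 1 ≤ f.cyc + n + 1) := by omega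
        have e3 : f.cyc + n + 1 ≠ f.cyc := by omega
        rw [if_pos rfl, if_neg e1, if_pos e2, shape_mX_of_ne S f e3, Bool.false_xor]
      · rw [if_neg ht]
        by_cases h2 : f.cyc < t ∧ t ≤ f.cyc + n
        · have h3 : f.cyc < t ∧ t ≤ f.cyc + n + 1 := by omega
          rw [if_pos h2, if_pos h3]
        · have h3 : ¬ (f.cyc < t ∧ t ≤ f.cyc + n + 1) := by omega
          rw [if_neg h2, if_neg h3]
    · funext t j
      dsimp only
      rw [run1F_dataXb, run1F_ancZx, hmZ]
      show _ = (if f.cyc < t ∧ t ≤ f.cyc + n + 1 then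
          xor (if t = f.cyc + 1 then (shape S f).frame.ancZx j else false) (synZ S (shape S f).frame.dataXb j)
        else (shape S f).mZ t j)
      by_cases ht : t = f.cyc + n + 1
      · subst ht
        have e1 : ¬ (f.cyc < f.cyc + n + 1 ∧ f.cyc + n + 1 ≤ f.cyc + n) := by omega
        have e2 : (f.cyc < f.cyc + n + 1 ∧ f.cyc + n + 1 ≤ f.cyc + n + 1) := by omega
        have e3 : f.cyc + n + 1 ≠ f.cyc := by omega
        rw [if_pos rfl, if_neg e1, if_pos e2, shape_mZ_of_ne S f e3, Bool.false_xor]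
        by_cases hn : n = 0
        · subst hn; simp
        · have e4 : ¬ f.cyc + n = f.cyc := by omega
          have e5 : ¬ f.cyc + n + 1 = f.cyc + 1 := by omega
          rw [if_neg e4, if_neg e5]
      · rw [if_neg ht]
        by_cases h2 : f.cyc < t ∧ t ≤ f.cyc + n
        · have h3 : f.cyc < t ∧ t ≤ f.cyc + n + 1 := by omega
          rw [if_pos h2, if_pos h3]
        · have h3 : ¬ (f.cyc < t ∧ t ≤ f.cyc + n + 1) := by omega
          rw [if_neg h2, if_neg h3]

/-- **STRUCTURE THEOREM.** For a fault in cycle `c ∈ [1, Nc]` the final state of the `Nc`-cycle circuit is the closed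
formula `run1F` in its one-cycle shape. -/
theorem run1_eq (S : SMCode ℓ m) (Nc : ℕ) (f : Fault ℓ m) (h₁ : 1 ≤ f.cyc) (h₂ : f.cyc ≤ Nc) :
    run1 S Nc f = run1F S Nc f := by
  obtain ⟨n, rfl⟩ : ∃ n, Nc = f.cyc + n := ⟨Nc - f.cyc, by omega⟩
  exact run1_eq_aux S f h₁ n

/-! ## Parity sums and linearity over fault sets -/

omit [NeZero ℓ] [NeZero m] in
/-- Parity sum over a singleton. -/
theorem bsum_singleton (f : Fault ℓ m) (g : Fault ℓ m → Bool) : bsum {f} g = g f := by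
  rw [← Finset.insert_empty, bsum_insert (Finset.notMem_empty f), bsum_empty, Bool.xor_false]

omit [NeZero ℓ] [NeZero m] in
/-- Parity sums split over `xor`. -/
theorem bsum_xor (F : Finset (Fault ℓ m)) (g h : Fault ℓ m → Bool) :
    bsum F (fun f => xor (g f) (h f)) = xor (bsum F g) (bsum F h) := by
  induction F using Finset.induction_on with
  | empty => simp
  | insert a F ha ih =>
    rw [bsum_insert ha, bsum_insert ha, bsum_insert ha, ih]
    cases g a <;> cases h a <;> cases bsum F g <;> cases bsum F h <;> rfl

omit [NeZero ℓ] [NeZero m] in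
/-- Parity sum of a pointwise-equal function. -/
theorem bsum_congr {F : Finset (Fault ℓ m)} {g h : Fault ℓ m → Bool} (hgh : ∀ f ∈ F, g f = h f) : bsum F g = bsum F h := by
  unfold bsum; rw [Finset.filter_congr (fun f hf => by rw [hgh f hf])]

omit [NeZero ℓ] [NeZero m] in
/-- Parity sum of a constant-false function. -/
theorem bsum_false (F : Finset (Fault ℓ m)) : bsum F (fun _ => false) = false := by
  unfold bsum; simp

omit [NeZero ℓ] [NeZero m] in
/-- `toZ2` of a parity sum is the sum of the `toZ2`. -/
theorem toZ2_bsum {α : Type*} (F : Finset (Fault ℓ m)) (g : Fault ℓ m → α → Bool) :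
    toZ2 (fun q => bsum F (fun f => g f q)) = ∑ f ∈ F, toZ2 (g f) := by
  induction F using Finset.induction_on with
  | empty => funext q; simp [toZ2]
  | insert a F ha ih =>
    rw [Finset.sum_insert ha, ← ih]
    have : (fun q => bsum (insert a F) fun f => g f q) = fun q => xor (g a q) (bsum F fun f => g f q) := by
      funext q; rw [bsum_insert ha]
    rw [this, toZ2_xor]

/-- One fault's `Z`-outcome flips. -/
theorem flipZ_singleton (S : SMCode ℓ m) (Nc : ℕ) (f : Fault ℓ m) (t : ℕ) (j : BB.Mono ℓ m) :
    flipZ S Nc {f} t j = (run1 S Nc f).mZ t j := by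
  unfold flipZ; rw [bsum_singleton]

/-- One fault's `X`-outcome flips. -/
theorem flipX_singleton (S : SMCode ℓ m) (Nc : ℕ) (f : Fault ℓ m) (t : ℕ) (i : BB.Mono ℓ m) :
    flipX S Nc {f} t i = (run1 S Nc f).mX t i := by
  unfold flipX; rw [bsum_singleton]

/-- Outcome flips are linear in the fault set (`Z`). -/
theorem flipZ_eq_bsum (S : SMCode ℓ m) (Nc : ℕ) (F : Finset (Fault ℓ m)) (t : ℕ) (j : BB.Mono ℓ m) :
    flipZ S Nc F t j = bsum F (fun f => flipZ S Nc {f} t j) := by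
  unfold flipZ; exact bsum_congr (fun f _ => (bsum_singleton f (fun f' => (run1 S Nc f').mZ t j)).symm)

/-- Outcome flips are linear in the fault set (`X`). -/
theorem flipX_eq_bsum (S : SMCode ℓ m) (Nc : ℕ) (F : Finset (Fault ℓ m)) (t : ℕ) (i : BB.Mono ℓ m) :
    flipX S Nc F t i = bsum F (fun f => flipX S Nc {f} t i) := by
  unfold flipX; exact bsum_congr (fun f _ => (bsum_singleton f (fun f' => (run1 S Nc f').mX t i)).symm)

/-- The residual `X`-error is the sum of the single-fault residuals. -/
theorem dataX_eq_sum (S : SMCode ℓ m) (Nc : ℕ) (F : Finset (Fault ℓ m)) :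
    dataX S Nc F = ∑ f ∈ F, dataX S Nc {f} := by
  have h : dataX S Nc F = toZ2 (fun q => bsum F fun f => ((run1 S Nc f).frame (q.elim (fun i => (Reg.L, i)) fun i => (Reg.R, i))).1) := rfl
  rw [h, toZ2_bsum]
  apply Finset.sum_congr rfl
  intro f _
  funext q; unfold dataX toZ2; rw [bsum_singleton]

/-- The residual `Z`-error is the sum of the single-fault residuals. -/
theorem dataZ_eq_sum (S : SMCode ℓ m) (Nc : ℕ) (F : Finset (Fault ℓ m)) :
    dataZ S Nc F = ∑ f ∈ F, dataZ S Nc {f} := by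
  have h : dataZ S Nc F = toZ2 (fun q => bsum F fun f => ((run1 S Nc f).frame (q.elim (fun i => (Reg.L, i)) fun i => (Reg.R, i))).2) := rfl
  rw [h, toZ2_bsum]
  apply Finset.sum_congr rfl
  intro f _
  funext q; unfold dataZ toZ2; rw [bsum_singleton]

/-- Residual `X`-error of one fault = data `x`-bits of its final frame. -/
theorem dataX_singleton_run1 (S : SMCode ℓ m) (Nc : ℕ) (f : Fault ℓ m) :
    dataX S Nc {f} = toZ2 (run1 S Nc f).frame.dataXb := by
  funext q; unfold dataX toZ2 Frame.dataXb; rw [bsum_singleton]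

/-- Residual `Z`-error of one fault = data `z`-bits of its final frame. -/
theorem dataZ_singleton_run1 (S : SMCode ℓ m) (Nc : ℕ) (f : Fault ℓ m) :
    dataZ S Nc {f} = toZ2 (run1 S Nc f).frame.dataZb := by
  funext q; unfold dataZ toZ2 Frame.dataZb; rw [bsum_singleton]

/-- Residual `X`-error of one fault inside the circuit = data `x`-bits of its SHAPE. -/
theorem dataX_singleton (S : SMCode ℓ m) (Nc : ℕ) (f : Fault ℓ m) (h₁ : 1 ≤ f.cyc) (h₂ : f.cyc ≤ Nc) :
    dataX S Nc {f} = toZ2 (shape S f).frame.dataXb := by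
  rw [dataX_singleton_run1, run1_eq S Nc f h₁ h₂, run1F_dataXb]

/-- Residual `Z`-error of one fault inside the circuit = data `z`-bits of its shape. -/
theorem dataZ_singleton (S : SMCode ℓ m) (Nc : ℕ) (f : Fault ℓ m) (h₁ : 1 ≤ f.cyc) (h₂ : f.cyc ≤ Nc) :
    dataZ S Nc {f} = toZ2 (shape S f).frame.dataZb := by
  rw [dataZ_singleton_run1, run1_eq S Nc f h₁ h₂, run1F_dataZb]

/-- `Z`-check detectors are `𝔽₂`-linear in the fault set. -/
theorem detZ_eq_bsum (S : SMCode ℓ m) (Nc : ℕ) (F : Finset (Fault ℓ m)) (t : ℕ) (j : BB.Mono ℓ m) :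
    detZ S Nc F t j = bsum F (fun f => detZ S Nc {f} t j) := by
  unfold detZ
  split_ifs with h0 h1 h2
  · rw [bsum_false]
  · rw [flipZ_eq_bsum S Nc F t, flipZ_eq_bsum S Nc F (t - 1), ← bsum_xor]
  · have : ∀ (G : Finset (Fault ℓ m)), decide ((S.toCode.HZ.mulVec (∑ f ∈ G, dataX S Nc {f})) j = 1) =
        bsum G (fun f => decide ((S.toCode.HZ.mulVec (dataX S Nc {f})) j = 1)) := by
      intro G
      induction G using Finset.induction_on with
      | empty => simp
      | insert a G ha ih =>
        rw [Finset.sum_insert ha, Matrix.mulVec_add, Pi.add_apply, bsum_insert ha, ← ih]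
        generalize (S.toCode.HZ.mulVec (dataX S Nc {a})) j = x
        generalize (S.toCode.HZ.mulVec (∑ f ∈ G, dataX S Nc {f})) j = y
        revert x y; decide
    rw [dataX_eq_sum, this F, flipZ_eq_bsum S Nc F Nc, ← bsum_xor]
  · rw [bsum_false]

/-- `X`-check detectors are `𝔽₂`-linear in the fault set. -/
theorem detX_eq_bsum (S : SMCode ℓ m) (Nc : ℕ) (F : Finset (Fault ℓ m)) (t : ℕ) (i : BB.Mono ℓ m) :
    detX S Nc F t i = bsum F (fun f => detX S Nc {f} t i) := by
  unfold detX
  split_ifs with h0 h1 h2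
  · rw [bsum_false]
  · rw [flipX_eq_bsum S Nc F t, flipX_eq_bsum S Nc F (t - 1), ← bsum_xor]
  · have : ∀ (G : Finset (Fault ℓ m)), decide ((S.toCode.HX.mulVec (∑ f ∈ G, dataZ S Nc {f})) i = 1) =
        bsum G (fun f => decide ((S.toCode.HX.mulVec (dataZ S Nc {f})) i = 1)) := by
      intro G
      induction G using Finset.induction_on with
      | empty => simp
      | insert a G ha ih =>
        rw [Finset.sum_insert ha, Matrix.mulVec_add, Pi.add_apply, bsum_insert ha, ← ih]
        generalize (S.toCode.HX.mulVec (dataZ S Nc {a})) i = x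
        generalize (S.toCode.HX.mulVec (∑ f ∈ G, dataZ S Nc {f})) i = y
        revert x y; decide
    rw [dataZ_eq_sum, this F, flipX_eq_bsum S Nc F Nc, ← bsum_xor]
  · rw [bsum_false]

end Summit.Ventures.QEC.CircuitDistance
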